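import Summits.HodgeConjecture.HodgeConjecture.Theorems.Ring2HypothesesDescentAbsoluteExternalProducts
import Summits.HodgeConjecture.HodgeConjecture.Theorems.Ring2HypothesesDescentAbsoluteRetraction
import Summits.HodgeConjecture.HodgeConjecture.Theorems.Ring2HypothesesDescentAbsoluteWeakDominationAbelian
import HarnessLib

/-!
# Ring 2 — hypotheses layer, descent axis: PRODUCTS AND POWERS OF WEAKLY ABSOLUTE-HODGE-DOMINATED VARIETIES —
# Deligne–Milne II Cor. 6.27, the «product of» clause, on the real carriers: Hodge classes on `Y ⊗ Y'` are absolute Hodge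
# whenever `Y`, `Y'` are weakly absolute-Hodge dominated by the powers of one abelian variety (mod c1 + (N)+(E) + V-B3 +
# CS7 + CS8); the weak class contains the strict (algebraic) class and every variety AH-EMBEDDED in every degree

HONEST FRAMING (page 1, verbatim the cell's standing line): **research route conditional on HC_CM; not a
corollary; Q11.4-sentence-2 already refuted in dim ≥ 3.** Nothing in this file proves a case of the Hodge conjecture;
nothing discharges the binder of record b06 `Ring2.Hypotheses.AbsoluteHodgeImpliesAlgebraicAV` (`Ring2HypothesesDescent.lean`
:73; OPEN) nor Deligne's Main Theorem 2.11 (fact c1, displayed as `hD`); the binder table's numbers do not move. `HC_CM`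
(`Theses.RankFourFaces.CMAbelianHodge`), `HC_AV` and row b06 do not occur in this file. Hodge ladder STAGE 3, `BINDER-OWNERS.md`
row **b06**, seat `ring2-b06` (gen 79), second file; consequences of the companion `Ring2HypothesesDescentAbsoluteExternalProducts`
(§2 `absoluteHodgeDomination_tensor`: weak absolute-Hodge domination, in all degrees, is stable under products).

* §3 THE WEAK ABSOLUTE-HODGE CLASS OF `X` (every `Hᵏ(Y(ℂ))` spanned by `[u]_* Hᵃ(Xᵉ)`, `u ∈ S(Y ⊗ Xᵉ)`): it contains every
  STRICTLY dominated `Y` (`absoluteHodgeDomination_of_isDominatedByPowers`, all degrees, mod V-B3 — gen 77 had the even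
  degrees), `X` itself and the point; it is stable under powers `Y^{m+1}` (`absoluteHodgeDomination_pow_succ`); and **it contains
  every `Y` AH-EMBEDDED into the powers of `X` in every degree** (`absoluteHodgeDomination_of_absoluteHodge_embeddings`: gen 78's
  absolute Hodge retraction `r ∘ ι = 1`, DM II 6.5 / Lemma 6.6 — the shape of Prop. 6.26 (d), Kuga–Satake, embedding NOT
  supplied); `absoluteHodgeDomination_two_mul` reads off gen 77's degree-`2p` hypothesis.
* §4 **DELIGNE–MILNE II COR. 6.27, PRODUCTS CLAUSE**: `hodgeClassesAreAbsoluteHodgeFor_tensor_of_absoluteHodgeDomination` (any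
  generating `X` with 11.2.17 on its powers ⟹ 11.2.17 on `Y ⊗ Y'`, mod (N)+(E)+V-B3+CS7+CS8);
  **`hodgeClasses_absoluteHodge_tensor_of_absoluteHodgeDomination_abelianVariety_of_deligne`** (generating ABELIAN VARIETY `A`:
  every rational `(p,p)`-class on `Y ⊗ Y'` is absolute Hodge, mod c1 + the five facts — printed 6.27 lists products of abelian
  varieties, curves, unirational threefolds, Fermat hypersurfaces, K3 surfaces; here: products of members of the weak class of
  `A`, which by §3 include abelian varieties, curves and their powers (strict) and AH-embedded varieties); and the row's
  bookkeeping `hodgeConjectureFor_tensor_iff_absoluteHodgeClassesAreAlgebraicFor_…` (on such products HC IS Charles–Schnell's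
  11.2.18; both OPEN, neither asserted).

HONEST COLUMN. Nothing is discharged; c1 and the six facts of record ((N), (E), V-B3, T1c — only in the embedding lemma —,
CS7, CS8) occur only as displayed hypotheses; no definition, no new named fact, no sorry. NOT obtained: the Kuga–Satake
embedding (6.26 (d)) or any Shioda–Katsura / unirational instance (6.26 (b)(c)); Artin motives; the `ℓ`-adic components;
anything for row b06 itself (algebraicity moves along ALGEBRAIC correspondences only).

PRESEARCH: as in the companion — [corpus: book:deligne1982-hodge-cycles-motives-shimura-varieties p0156 L7–22 (II Thm. 6.25,
Prop. 6.26, Cor. 6.27 and the first lines of the proof of 6.26), p0146 L11 (tensor structure)]; galaxy all stars «absolutely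
Hodge|tensor subcategory generated» → DM LNM 900 / Milne 2003 re-edition only; no realisation-level statement of the products
clause in print beyond DM ⇒ certification by assembly, no novelty claimed.

References (bib keys): DeligneMilne1982Tannakian (II Prop. 6.1, 6.5, Lemma 6.6, Thm. 6.25, Prop. 6.26, Cor. 6.27),
Deligne1982HodgeCycles (Main Thm. 2.11, §2 Ex. 2.1), Arapura2006 (§1 Lemma 1.1, §4 Lemma 4.2), CharlesSchnell2014Notes (§11.2.5
statements 11.2.17–11.2.18), Fulton1998 (§16.1), HatcherAT2002 (§3.2 Thm. 3.15), Voisin2025 (Cor. 2.12).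
-/

noncomputable section

set_option linter.dupNamespace false

open CategoryTheory AlgebraicGeometry MonoidalCategory CartesianMonoidalCategory
open Literature.AlgebraicTopology.SingularHomology Literature.Geometry.Kaehler
open Literature.AlgebraicGeometry Literature.AlgebraicGeometry.Motives
open Literature.AlgebraicGeometry.HodgeTheory
open Summit.HodgeConjecture.HodgeConjecture.Theorems
open Summit.HodgeConjecture.CorCM.Stage4 (isDominatedByPowers_self isDominatedByPowers_unit)

namespace Summit.HodgeConjecture.HodgeConjecture.Ring2.Hypotheses

/-! ## §3 The weak absolute-Hodge class of `X`: the point, `X` itself, strictly dominated and AH-embedded varieties, powers -/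

section Closure

variable {dX dY : ℕ} {X Y : SchemeOver ℂ}

/-- **Strict (algebraic) domination is weak absolute-Hodge domination, in every degree** (mod V-B3): the algebraic
correspondences of `HodgeTheory.IsDominatedByPowers` are absolute Hodge ones (gen 78's
`exists_eq_corrAction_absoluteHodge_of_isAlgebraicCorrespondence`). gen 77's `span_absoluteHodgeCorrRanges_eq_top_of_isDominatedByPowers`
is the even-degree case. [cite: Arapura2006, §1 Lemma 1.1] [cite: Deligne1982HodgeCycles, §2 Example 2.1 (a) (p. 16)] -/
theorem absoluteHodgeDomination_of_isDominatedByPowers (hZ : deligne1982_cycleClass_absoluteHodge)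
    (hX : IsSmoothProjective dX X) (hY : IsSmoothProjective dY Y) (hdom : IsDominatedByPowers dY Y dX X) :
    ∀ k : ℕ, Submodule.span ℂ
        {c : complexBetti Y k |
          ∃ (e cd a : ℕ) (hab : a + 2 * cd = k + 2 * (e * dX)) (u : complexBetti (Y ⊗ X.pow e) (2 * cd)),
            u ∈ Submodule.span ℂ {c : complexBetti (Y ⊗ X.pow e) (2 * cd) |
                IsAbsoluteHodgeClass (dY + e * dX) (Y ⊗ X.pow e) cd c} ∧
              c ∈ LinearMap.range (corrAction complexOrientationFamily hY (hX.pow e) hab u)} = ⊤ := by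
  intro k
  refine eq_top_iff.2 ((hdom k).symm.le.trans (Submodule.span_mono ?_))
  rintro c ⟨e, a, T, hT, hc⟩
  obtain ⟨cd, hab, u, hu, rfl⟩ := exists_eq_corrAction_absoluteHodge_of_isAlgebraicCorrespondence hZ hY (hX.pow e) hT
  exact ⟨e, cd, a, hab, u, hu, hc⟩

/-- **`X` is weakly absolute-Hodge dominated by its own powers** (mod V-B3; the identity correspondence from `X¹`: the
Stage-4 seat's `isDominatedByPowers_self`). Anti-vacuity of the hypothesis of §2. [cite: Arapura2006, §1 Lemma 1.1] -/
theorem absoluteHodgeDomination_self (hZ : deligne1982_cycleClass_absoluteHodge) (hX : IsSmoothProjective dX X) :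
    ∀ k : ℕ, Submodule.span ℂ
        {c : complexBetti X k |
          ∃ (e cd a : ℕ) (hab : a + 2 * cd = k + 2 * (e * dX)) (u : complexBetti (X ⊗ X.pow e) (2 * cd)),
            u ∈ Submodule.span ℂ {c : complexBetti (X ⊗ X.pow e) (2 * cd) |
                IsAbsoluteHodgeClass (dX + e * dX) (X ⊗ X.pow e) cd c} ∧
              c ∈ LinearMap.range (corrAction complexOrientationFamily hX (hX.pow e) hab u)} = ⊤ :=
  absoluteHodgeDomination_of_isDominatedByPowers hZ hX hX (isDominatedByPowers_self hX)

/-- **The point `Spec ℂ = X⁰` is weakly absolute-Hodge dominated by the powers of any `X`** (mod V-B3; the Stage-4 seat's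
`isDominatedByPowers_unit`). [cite: Arapura2006, §1 Lemma 1.1] -/
theorem absoluteHodgeDomination_unit (hZ : deligne1982_cycleClass_absoluteHodge) (hX : IsSmoothProjective dX X) :
    ∀ k : ℕ, Submodule.span ℂ
        {c : complexBetti (𝟙_ (SchemeOver ℂ)) k |
          ∃ (e cd a : ℕ) (hab : a + 2 * cd = k + 2 * (e * dX)) (u : complexBetti (𝟙_ (SchemeOver ℂ) ⊗ X.pow e) (2 * cd)),
            u ∈ Submodule.span ℂ {c : complexBetti (𝟙_ (SchemeOver ℂ) ⊗ X.pow e) (2 * cd) |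
                IsAbsoluteHodgeClass (0 + e * dX) (𝟙_ (SchemeOver ℂ) ⊗ X.pow e) cd c} ∧
              c ∈ LinearMap.range
                (corrAction complexOrientationFamily (isSmoothProjective_unit_holds ℂ) (hX.pow e) hab u)} = ⊤ :=
  absoluteHodgeDomination_of_isDominatedByPowers hZ hX (isSmoothProjective_unit_holds ℂ) (isDominatedByPowers_unit hX)

/-- Bookkeeping: the weak domination statement does not depend on the name of the dimension of `Y` (nor on the proof that
`Y` is smooth projective of that dimension). [folklore] -/
theorem absoluteHodgeDomination_congr_dim {dY dY' : ℕ} (h : dY = dY') (hX : IsSmoothProjective dX X)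
    (hY : IsSmoothProjective dY Y) (hY' : IsSmoothProjective dY' Y)
    (hdom : ∀ k : ℕ, Submodule.span ℂ
        {c : complexBetti Y k |
          ∃ (e cd a : ℕ) (hab : a + 2 * cd = k + 2 * (e * dX)) (u : complexBetti (Y ⊗ X.pow e) (2 * cd)),
            u ∈ Submodule.span ℂ {c : complexBetti (Y ⊗ X.pow e) (2 * cd) |
                IsAbsoluteHodgeClass (dY + e * dX) (Y ⊗ X.pow e) cd c} ∧
              c ∈ LinearMap.range (corrAction complexOrientationFamily hY (hX.pow e) hab u)} = ⊤) :
    ∀ k : ℕ, Submodule.span ℂ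
        {c : complexBetti Y k |
          ∃ (e cd a : ℕ) (hab : a + 2 * cd = k + 2 * (e * dX)) (u : complexBetti (Y ⊗ X.pow e) (2 * cd)),
            u ∈ Submodule.span ℂ {c : complexBetti (Y ⊗ X.pow e) (2 * cd) |
                IsAbsoluteHodgeClass (dY' + e * dX) (Y ⊗ X.pow e) cd c} ∧
              c ∈ LinearMap.range (corrAction complexOrientationFamily hY' (hX.pow e) hab u)} = ⊤ := by
  subst h
  exact hdom

/-- **The powers of a weakly absolute-Hodge-dominated variety are weakly absolute-Hodge dominated** (mod (N)+(E) + V-B3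
+ CS7 + CS8): `Y^{m+1} = Yᵐ ⊗ Y`, induction with §2 from the point `Y⁰` (the Stage-4 seat's `isDominatedByPowers_pow_succ`,
absolute Hodge twin). [cite: DeligneMilne1982Tannakian, II Cor. 6.27] [cite: Arapura2006, §4 Lemma 4.2] -/
theorem absoluteHodgeDomination_pow_succ (hN : chartConjugation_canonical)
    (hex : ∀ ⦃n : ℕ⦄ ⦃X : SchemeOver ℂ⦄, IsSmoothProjective n X →
      ∀ (σ : ℂ ≃+* ℂ) (p : ℕ) (c : complexBetti X (2 * p)), ∃ s, IsConjugateClass σ X (2 * p) c s)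
    (hZ : deligne1982_cycleClass_absoluteHodge) (hcup : deligne1982_cupProduct_absoluteHodge)
    (hgys : deligne1982_gysinFst_absoluteHodge) (hX : IsSmoothProjective dX X) (hY : IsSmoothProjective dY Y)
    (hdom : ∀ k : ℕ, Submodule.span ℂ
        {c : complexBetti Y k |
          ∃ (e cd a : ℕ) (hab : a + 2 * cd = k + 2 * (e * dX)) (u : complexBetti (Y ⊗ X.pow e) (2 * cd)),
            u ∈ Submodule.span ℂ {c : complexBetti (Y ⊗ X.pow e) (2 * cd) |
                IsAbsoluteHodgeClass (dY + e * dX) (Y ⊗ X.pow e) cd c} ∧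
              c ∈ LinearMap.range (corrAction complexOrientationFamily hY (hX.pow e) hab u)} = ⊤) :
    ∀ (m k : ℕ), Submodule.span ℂ
        {c : complexBetti (Y.pow (m + 1)) k |
          ∃ (e cd a : ℕ) (hab : a + 2 * cd = k + 2 * (e * dX)) (u : complexBetti (Y.pow (m + 1) ⊗ X.pow e) (2 * cd)),
            u ∈ Submodule.span ℂ {c : complexBetti (Y.pow (m + 1) ⊗ X.pow e) (2 * cd) |
                IsAbsoluteHodgeClass ((m + 1) * dY + e * dX) (Y.pow (m + 1) ⊗ X.pow e) cd c} ∧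
              c ∈ LinearMap.range (corrAction complexOrientationFamily (hY.pow (m + 1)) (hX.pow e) hab u)} = ⊤
  | 0 => absoluteHodgeDomination_congr_dim (by omega) hX
      (IsSmoothProjective.tensor_holds (isSmoothProjective_unit_holds ℂ) hY) (hY.pow (0 + 1))
      (absoluteHodgeDomination_tensor hN hex hZ hcup hgys hX (isSmoothProjective_unit_holds ℂ) hY
        (absoluteHodgeDomination_unit hZ hX) hdom)
  | m + 1 => absoluteHodgeDomination_congr_dim (by ring) hX
      (IsSmoothProjective.tensor_holds (hY.pow (m + 1)) hY) (hY.pow (m + 1 + 1))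
      (absoluteHodgeDomination_tensor hN hex hZ hcup hgys hX (hY.pow (m + 1)) hY
        (absoluteHodgeDomination_pow_succ hN hex hZ hcup hgys hX hY hdom m) hdom)

/-- **A variety AH-EMBEDDED into the powers of `X` in every degree is weakly absolute-Hodge dominated by them** (mod the six
facts of record, T1c included): if every `Hᵏ(Y(ℂ); ℂ)`, `k ≤ 2 dim Y`, admits an INJECTIVE absolute Hodge correspondence
`ι_k : Hᵏ(Y) ↪ Hᵃ(Xᵉ)` (`a ≤ 2 e·dim X`), then gen 78's absolute Hodge retraction `r_k ∘ ι_k = 1`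
(`exists_absoluteHodge_retraction_of_injective`; DM II 6.5 / Lemma 6.6) exhibits `Hᵏ(Y) = r_k(Hᵃ(Xᵉ))`. This is the shape
of Deligne–Milne II Prop. 6.26 (d) (Kuga–Satake; the embedding itself is NOT supplied here).
[cite: DeligneMilne1982Tannakian, II Prop. 6.5, Lemma 6.6 and Prop. 6.26 (d)] -/
theorem absoluteHodgeDomination_of_absoluteHodge_embeddings (hN : chartConjugation_canonical)
    (hex : ∀ ⦃n : ℕ⦄ ⦃X : SchemeOver ℂ⦄, IsSmoothProjective n X →
      ∀ (σ : ℂ ≃+* ℂ) (p : ℕ) (c : complexBetti X (2 * p)), ∃ s, IsConjugateClass σ X (2 * p) c s)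
    (hZ : deligne1982_cycleClass_absoluteHodge) (hL : deligne1982_lefschetz_absoluteHodge_iff)
    (hcup : deligne1982_cupProduct_absoluteHodge) (hgys : deligne1982_gysinFst_absoluteHodge)
    (hX : IsSmoothProjective dX X) (hY : IsSmoothProjective dY Y)
    (hemb : ∀ k ≤ 2 * dY, ∃ (e a cd : ℕ) (hab : k + 2 * cd = a + 2 * dY) (γ : complexBetti (X.pow e ⊗ Y) (2 * cd)),
      γ ∈ Submodule.span ℂ {c : complexBetti (X.pow e ⊗ Y) (2 * cd) | IsAbsoluteHodgeClass (e * dX + dY) (X.pow e ⊗ Y) cd c} ∧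
        a ≤ 2 * (e * dX) ∧ Function.Injective (corrAction complexOrientationFamily (hX.pow e) hY hab γ)) :
    ∀ k : ℕ, Submodule.span ℂ
        {c : complexBetti Y k |
          ∃ (e cd a : ℕ) (hab : a + 2 * cd = k + 2 * (e * dX)) (u : complexBetti (Y ⊗ X.pow e) (2 * cd)),
            u ∈ Submodule.span ℂ {c : complexBetti (Y ⊗ X.pow e) (2 * cd) |
                IsAbsoluteHodgeClass (dY + e * dX) (Y ⊗ X.pow e) cd c} ∧
              c ∈ LinearMap.range (corrAction complexOrientationFamily hY (hX.pow e) hab u)} = ⊤ := by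
  intro k
  refine eq_top_iff.2 fun c _ ↦ ?_
  by_cases hk : k ≤ 2 * dY; swap
  · haveI := subsingleton_complexBetti hY (not_le.1 hk)
    rw [Subsingleton.elim c 0]
    exact Submodule.zero_mem _
  obtain ⟨e, a, cd, hab, γ, hγ, ha, hinj⟩ := hemb k hk
  obtain ⟨r, ⟨e', hab', γ', hγ', hr⟩, hrι⟩ := exists_absoluteHodge_retraction_of_injective hN hex hZ hL hcup hgys hY
    (hX.pow e) hk ha ⟨cd, hab, γ, hγ, rfl⟩ hinj
  refine Submodule.subset_span ⟨e, e', a, hab', γ', hγ', corrAction complexOrientationFamily (hX.pow e) hY hab γ c, ?_⟩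
  rw [← hr]
  simpa only [LinearMap.comp_apply, LinearMap.id_apply] using LinearMap.congr_fun hrι c

/-- **The even-degree reading**: weak absolute-Hodge domination in every degree gives gen 77's degree-`2p` hypothesis (the
source degree `a` of a correspondence into `H²ᵖ` is even, `a + 2cd = 2p + 2e·dim X`). [folklore] -/
theorem absoluteHodgeDomination_two_mul (hX : IsSmoothProjective dX X) (hY : IsSmoothProjective dY Y)
    (hdom : ∀ k : ℕ, Submodule.span ℂ
        {c : complexBetti Y k |
          ∃ (e cd a : ℕ) (hab : a + 2 * cd = k + 2 * (e * dX)) (u : complexBetti (Y ⊗ X.pow e) (2 * cd)),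
            u ∈ Submodule.span ℂ {c : complexBetti (Y ⊗ X.pow e) (2 * cd) |
                IsAbsoluteHodgeClass (dY + e * dX) (Y ⊗ X.pow e) cd c} ∧
              c ∈ LinearMap.range (corrAction complexOrientationFamily hY (hX.pow e) hab u)} = ⊤) (p : ℕ) :
    Submodule.span ℂ
        {c : complexBetti Y (2 * p) |
          ∃ (e cd d : ℕ) (hab : 2 * d + 2 * cd = 2 * p + 2 * (e * dX)) (u : complexBetti (Y ⊗ X.pow e) (2 * cd)),
            u ∈ Submodule.span ℂ {c : complexBetti (Y ⊗ X.pow e) (2 * cd) |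
                IsAbsoluteHodgeClass (dY + e * dX) (Y ⊗ X.pow e) cd c} ∧
              c ∈ LinearMap.range (corrAction complexOrientationFamily hY (hX.pow e) hab u)} = ⊤ := by
  refine eq_top_iff.2 ((hdom (2 * p)).symm.le.trans (Submodule.span_mono ?_))
  rintro c ⟨e, cd, a, hab, u, hu, hc⟩
  obtain ⟨d, rfl⟩ : ∃ d, a = 2 * d := ⟨a / 2, by omega⟩
  exact ⟨e, cd, d, hab, u, hu, hc⟩

end Closure

/-! ## §4 Deligne–Milne II Cor. 6.27, the PRODUCTS clause, on the absolute road -/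

section Consequences

variable {dX dY dY' : ℕ} {X Y Y' : SchemeOver ℂ}

/-- **STATEMENT 11.2.17 PASSES TO PRODUCTS OF WEAKLY ABSOLUTE-HODGE-DOMINATED VARIETIES** (mod (N)+(E) + V-B3 + CS7 + CS8):
if `Y` and `Y'` are weakly absolute-Hodge dominated by the powers of `X` (every degree) and every rational Hodge class on
every power `Xᵉ` is absolute Hodge, then every rational Hodge class on `Y ⊗ Y'` is absolute Hodge — §2 (the product is
weakly dominated) and gen 77's descent `hodgeClassesAreAbsoluteHodgeFor_of_absoluteHodgeDomination`. Deligne–Milne II 6.27's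
«product of» clause at realisation level, for an arbitrary generating `X`. Hypotheses displayed, not asserted.
[cite: DeligneMilne1982Tannakian, II Thm. 6.25 and Cor. 6.27] [cite: CharlesSchnell2014Notes, §11.2.5 statement 11.2.17]
[cite: Arapura2006, §4 Lemma 4.2] -/
theorem hodgeClassesAreAbsoluteHodgeFor_tensor_of_absoluteHodgeDomination (hN : chartConjugation_canonical)
    (hex : ∀ ⦃n : ℕ⦄ ⦃X : SchemeOver ℂ⦄, IsSmoothProjective n X →
      ∀ (σ : ℂ ≃+* ℂ) (p : ℕ) (c : complexBetti X (2 * p)), ∃ s, IsConjugateClass σ X (2 * p) c s)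
    (hZ : deligne1982_cycleClass_absoluteHodge) (hcup : deligne1982_cupProduct_absoluteHodge)
    (hgys : deligne1982_gysinFst_absoluteHodge) (hX : IsSmoothProjective dX X) (hY : IsSmoothProjective dY Y)
    (hY' : IsSmoothProjective dY' Y')
    (hdY : ∀ k : ℕ, Submodule.span ℂ
        {c : complexBetti Y k |
          ∃ (e cd a : ℕ) (hab : a + 2 * cd = k + 2 * (e * dX)) (u : complexBetti (Y ⊗ X.pow e) (2 * cd)),
            u ∈ Submodule.span ℂ {c : complexBetti (Y ⊗ X.pow e) (2 * cd) |
                IsAbsoluteHodgeClass (dY + e * dX) (Y ⊗ X.pow e) cd c} ∧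
              c ∈ LinearMap.range (corrAction complexOrientationFamily hY (hX.pow e) hab u)} = ⊤)
    (hdY' : ∀ k : ℕ, Submodule.span ℂ
        {c : complexBetti Y' k |
          ∃ (e cd a : ℕ) (hab : a + 2 * cd = k + 2 * (e * dX)) (u : complexBetti (Y' ⊗ X.pow e) (2 * cd)),
            u ∈ Submodule.span ℂ {c : complexBetti (Y' ⊗ X.pow e) (2 * cd) |
                IsAbsoluteHodgeClass (dY' + e * dX) (Y' ⊗ X.pow e) cd c} ∧
              c ∈ LinearMap.range (corrAction complexOrientationFamily hY' (hX.pow e) hab u)} = ⊤)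
    (hpow : ∀ e : ℕ, HodgeClassesAreAbsoluteHodgeFor (e * dX) (X.pow e)) :
    HodgeClassesAreAbsoluteHodgeFor (dY + dY') (Y ⊗ Y') :=
  hodgeClassesAreAbsoluteHodgeFor_of_absoluteHodgeDomination hN hex hcup hgys hX (IsSmoothProjective.tensor_holds hY hY')
    (absoluteHodgeDomination_two_mul hX (IsSmoothProjective.tensor_holds hY hY')
      (absoluteHodgeDomination_tensor hN hex hZ hcup hgys hX hY hY' hdY hdY'))
    hpow

/-- **DELIGNE–MILNE II COR. 6.27, PRODUCTS CLAUSE, WEAK FORM ON THE REAL CARRIERS** (mod c1 + (N)+(E) + V-B3 + CS7 + CS8):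
for a complex ABELIAN VARIETY `A` and smooth projective `Y`, `Y'` weakly absolute-Hodge dominated by the powers `A.Xᵉ` (every
degree), every rational `(p,p)`-class on `Y ⊗ Y'` is absolute Hodge. 11.2.17 on the powers of `A` is Deligne's Main Theorem
2.11 (c1, displayed as `hD`, NOT asserted; gen 76's `hodgeClasses_absoluteHodge_pow_abelianVariety_of_deligne`). With §3 this
covers products of: abelian varieties and their powers, curves and their powers (strict class), and any `Y` AH-embedded in the
powers of `A` in every degree (the K3 shape of DM 6.26 (d), embedding not supplied) — and products of such products.
[cite: DeligneMilne1982Tannakian, II Thm. 6.25, Prop. 6.26 and Cor. 6.27] [cite: Deligne1982HodgeCycles, Main Thm. 2.11] -/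
theorem hodgeClasses_absoluteHodge_tensor_of_absoluteHodgeDomination_abelianVariety_of_deligne
    (hN : chartConjugation_canonical)
    (hex : ∀ ⦃n : ℕ⦄ ⦃X : SchemeOver ℂ⦄, IsSmoothProjective n X →
      ∀ (σ : ℂ ≃+* ℂ) (p : ℕ) (c : complexBetti X (2 * p)), ∃ s, IsConjugateClass σ X (2 * p) c s)
    (hZ : deligne1982_cycleClass_absoluteHodge) (hcup : deligne1982_cupProduct_absoluteHodge)
    (hgys : deligne1982_gysinFst_absoluteHodge) (hD : deligne1982_hodgeClasses_abelianVariety_absoluteHodge)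
    (A : AbelianVariety ℂ) (hY : IsSmoothProjective dY Y) (hY' : IsSmoothProjective dY' Y')
    (hdY : ∀ k : ℕ, Submodule.span ℂ
        {c : complexBetti Y k |
          ∃ (e cd a : ℕ) (hab : a + 2 * cd = k + 2 * (e * A.dim)) (u : complexBetti (Y ⊗ A.X.pow e) (2 * cd)),
            u ∈ Submodule.span ℂ {c : complexBetti (Y ⊗ A.X.pow e) (2 * cd) |
                IsAbsoluteHodgeClass (dY + e * A.dim) (Y ⊗ A.X.pow e) cd c} ∧
              c ∈ LinearMap.range
                (corrAction complexOrientationFamily hY ((AbelianVariety.isSmoothProjective_holds (A := A)).pow e) hab u)} = ⊤)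
    (hdY' : ∀ k : ℕ, Submodule.span ℂ
        {c : complexBetti Y' k |
          ∃ (e cd a : ℕ) (hab : a + 2 * cd = k + 2 * (e * A.dim)) (u : complexBetti (Y' ⊗ A.X.pow e) (2 * cd)),
            u ∈ Submodule.span ℂ {c : complexBetti (Y' ⊗ A.X.pow e) (2 * cd) |
                IsAbsoluteHodgeClass (dY' + e * A.dim) (Y' ⊗ A.X.pow e) cd c} ∧
              c ∈ LinearMap.range
                (corrAction complexOrientationFamily hY' ((AbelianVariety.isSmoothProjective_holds (A := A)).pow e) hab u)} = ⊤)
    (p : ℕ) {c : complexBetti (Y ⊗ Y') (2 * p)} (hc : IsRationalClass c)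
    (hpp : IsOfHodgeType (dY + dY') (Y ⊗ Y') (2 * p) p p c) :
    IsAbsoluteHodgeClass (dY + dY') (Y ⊗ Y') p c :=
  hodgeClasses_absoluteHodge_of_absoluteHodgeDomination_abelianVariety_of_deligne hN hex hcup hgys hD A
    (IsSmoothProjective.tensor_holds hY hY') p
    (absoluteHodgeDomination_two_mul AbelianVariety.isSmoothProjective_holds (IsSmoothProjective.tensor_holds hY hY')
      (absoluteHodgeDomination_tensor hN hex hZ hcup hgys AbelianVariety.isSmoothProjective_holds hY hY' hdY hdY') p)
    hc hpp

/-- **Consequence for the row's bookkeeping: on such products the Hodge conjecture IS Charles–Schnell's 11.2.18**,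
`HodgeConjectureFor (dY + dY') (Y ⊗ Y') ↔ AbsoluteHodgeClassesAreAlgebraicFor (dY + dY') (Y ⊗ Y')` (mod c1 + the five
facts) — gen 77's `hodgeConjectureFor_iff_absoluteHodgeClassesAreAlgebraicFor_of_absoluteHodgeDomination_abelianVariety` at the
product. Both sides OPEN; nothing of row b06 is claimed. [cite: DeligneMilne1982Tannakian, II Cor. 6.27]
[cite: CharlesSchnell2014Notes, §11.2.5 statements 11.2.17–11.2.18] -/
theorem hodgeConjectureFor_tensor_iff_absoluteHodgeClassesAreAlgebraicFor_of_absoluteHodgeDomination_abelianVariety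
    (hN : chartConjugation_canonical)
    (hex : ∀ ⦃n : ℕ⦄ ⦃X : SchemeOver ℂ⦄, IsSmoothProjective n X →
      ∀ (σ : ℂ ≃+* ℂ) (p : ℕ) (c : complexBetti X (2 * p)), ∃ s, IsConjugateClass σ X (2 * p) c s)
    (hZ : deligne1982_cycleClass_absoluteHodge) (hcup : deligne1982_cupProduct_absoluteHodge)
    (hgys : deligne1982_gysinFst_absoluteHodge) (hD : deligne1982_hodgeClasses_abelianVariety_absoluteHodge)
    (A : AbelianVariety ℂ) (hY : IsSmoothProjective dY Y) (hY' : IsSmoothProjective dY' Y')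
    (hdY : ∀ k : ℕ, Submodule.span ℂ
        {c : complexBetti Y k |
          ∃ (e cd a : ℕ) (hab : a + 2 * cd = k + 2 * (e * A.dim)) (u : complexBetti (Y ⊗ A.X.pow e) (2 * cd)),
            u ∈ Submodule.span ℂ {c : complexBetti (Y ⊗ A.X.pow e) (2 * cd) |
                IsAbsoluteHodgeClass (dY + e * A.dim) (Y ⊗ A.X.pow e) cd c} ∧
              c ∈ LinearMap.range
                (corrAction complexOrientationFamily hY ((AbelianVariety.isSmoothProjective_holds (A := A)).pow e) hab u)} = ⊤)
    (hdY' : ∀ k : ℕ, Submodule.span ℂ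
        {c : complexBetti Y' k |
          ∃ (e cd a : ℕ) (hab : a + 2 * cd = k + 2 * (e * A.dim)) (u : complexBetti (Y' ⊗ A.X.pow e) (2 * cd)),
            u ∈ Submodule.span ℂ {c : complexBetti (Y' ⊗ A.X.pow e) (2 * cd) |
                IsAbsoluteHodgeClass (dY' + e * A.dim) (Y' ⊗ A.X.pow e) cd c} ∧
              c ∈ LinearMap.range
                (corrAction complexOrientationFamily hY' ((AbelianVariety.isSmoothProjective_holds (A := A)).pow e) hab u)} = ⊤) :
    HodgeConjectureFor (dY + dY') (Y ⊗ Y') ↔ AbsoluteHodgeClassesAreAlgebraicFor (dY + dY') (Y ⊗ Y') :=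
  hodgeConjectureFor_iff_absoluteHodgeClassesAreAlgebraicFor_of_absoluteHodgeDomination_abelianVariety hN hex hcup hgys hD A
    (IsSmoothProjective.tensor_holds hY hY') fun p ↦
      absoluteHodgeDomination_two_mul AbelianVariety.isSmoothProjective_holds (IsSmoothProjective.tensor_holds hY hY')
        (absoluteHodgeDomination_tensor hN hex hZ hcup hgys AbelianVariety.isSmoothProjective_holds hY hY' hdY hdY') p

end Consequences

/-! ## Audit: nothing is decided here

Every theorem above is an implication out of displayed named facts of record (c1 `hD`, (N) `hN`, (E) `hex`, V-B3 `hZ`, T1c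
`hL`, CS7 `hcup`, CS8 `hgys`) and displayed OPEN hypotheses (weak domination, AH embeddings, 11.2.17 on powers), or an
equivalence between two OPEN per-variety statements modulo them; `HC_CM`, `HC_AV`, row b06 do not occur. -/

end Summit.HodgeConjecture.HodgeConjecture.Ring2.Hypotheses

end
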